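import Summits.QuantumFields.BalabanUV.Beta.SymCorrectorFace
import Summits.QuantumFields.BalabanUV.Beta.D1BFx.PackedColumnBlockIndexedMass
import Summits.QuantumFields.BalabanUV.Beta.BondIndicatorGaugeL1
import Summits.QuantumFields.BalabanUV.Beta.BlockFaceCount

/-!
# `BalabanUV.Beta.D1BFx.PackedPairFaceSumMass` — road «BF-x» junction (J1), the PAIR contact families: **«PAIR-FACE-SUM-MASS» — THE THREE FACE-SUM PAIR
# TABLES OF «PAIR-FACE-PACK» (outer face × raw, raw × inner face, face × face) GET THEIR BLOCK-PAIR LETTERS `N⁷ ∕ N⁷ ∕ N⁶` FROM ONE DISPLAYED PER-SLOT-PAIR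
# LETTER OF THE RAW PAIR TABLE WITH TWO-SLOT BLOCK-SCALE DECAY** (UNCONDITIONAL; [folklore] counting BY NAME over «FACE-COUNT», leaf-03's TT3a and
# d1-leaf-02's finite-sum mass lemma)

HONEST DEPENDENCY (cell records, verbatim): «continuum YM on T⁴ ⇐ BetaPertH ∧ nine spine estimates (0/9 proved); BetaPertH ⇐ (D1) ∧ (D4) ∧
CAP+tail; G-an2-4 gates asym, D1 and NE2/3/4.»  HONEST FRAMING (cell contract, verbatim): «discharging `BetaPertH` makes Bałaban's UV stability
UNCONDITIONAL — a real constructive-QFT result; it is NOT the continuum limit and NOT the Clay problem.»  THIS MODULE DISCHARGES NOTHING of the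
wall: [folklore] finite counting and `ℓ¹` bookkeeping BY NAME (leaf-03's `SymCorrectorFace.faceSum_eq_sum_sigma` ∕ `l1_le_of_mem_bondNbhd`, this lineage's
`BlockFaceCount.sum_univ_sum_abs_gaugeWt_le` ∕ `BondIndicatorGaugeL1.sum_box_abs_zetaS_delta1_le` ∕ `PackedColumnBlockIndexedMass.blk_finset_sum_smul`, d1-leaf-02's
`GhostWordJetMass.mass_finset_sum_le`).  The ONE letter is a DISPLAYED hypothesis on an ARBITRARY pair family `S₂` (`hBm`: plain per-slot-pair block masses
`≤ mB j i·e^{−(θ∕N)|u′−u|₁}`, the END's pair currency — `PackedColumnBlockTotalOfPerSlot.hTB_of_hBm`'s input); nothing of Bałaban's (or an1's ∕ an3's) tables asserted.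
No definition, no `def … : Prop`, nothing cited, 0 sorry.  NO (1.22) row and no [M] row PRICED (the road types no [M] row on the contact families before the decider,
OWNER d1-p2 g23 W-g23-3); 0 root-level binders of row D1 discharged; (J1) = ONE OPEN ROW; [W] OPEN; (K) NOT closed; NOT D1, NOT `BetaPertH`, NOT continuum, NOT Clay.

ABSOLUTE RULE (cell charter, verbatim): «No internally-minted statement may enter as a cited fact. Every hypothesis is either kernel-proved in
this package or a verbatim quotation of a PUBLISHED theorem with page reference. The manuscript(s) under audit are NOT citable for their own
disputed steps — they are the thing under adjudication; programme-internal (2001/route/tribunal) claims are never citable.»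

WHY: leaf-03's TT6 `SymCorrectorRest.slotPsiS₂_expand` writes the doubly transported pair family as `S₂ + faceWt α x • faceSum n S₂ (blk x) + faceWt κ′ u′ • faceSum n (S₂ α x) (blk u′)
+ (faceWt α x·faceWt κ′ u′) • faceSum n (faceSum n S₂ (blk x)) (blk u′)`; «PAIR-FACE-PACK» (`PackedPairBlockIndexedMass` §2) turns the three pieces into `hTB` letters GIVEN
three pair-mass letters for the face-sum tables — `Σ_{b′} M(blk (faceSum N S₂ y₁ κ′ (N•y₂+b′))) ≤ N⁷·m̄G·e^{−θ|y₂−y₁|₁}`, its inner twin (`N⁷`), and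
`M(blk (faceSum N (faceSum N S₂ y₁) y₂)) ≤ N⁶·m̄J·e^{−θ|y₂−y₁|₁}`.  This file PROVES the three from ONE per-slot-pair letter of the raw table with two-slot decay at the
block-scale rate: a face sum carries `Σ_κ Σ_u |gaugeWt N y κ u| ≤ (3+1)·2N³` unit weights («FACE-COUNT»), all its slots lie within `(3+1)·N` of `N•y`
(`l1_le_of_mem_bondNbhd`), so the two-slot decay is read in block units at the cost `e^{8θ}` (§1) and the free box contributes `N⁴`: `8N³·N⁴ = 8N⁷` (twice) and
`8N³·8N³ = 64N⁶`.  The sequel `PackedPairFaceContactMass` assembles the contact family's `hTB` and its (M-b) packed bi-vertex row.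

CONTENT ([folklore]).  §1 tools: `exp_pairSlot_le` (generic `D`), `exp_pairSlot_le_four`, `l1_sub_nsmul_le_of_mem_bondNbhd` (generic `d`), `l1_sub_nsmul_le_of_mem_box`,
`sum_box_abs_faceWt_ctrOff_le` (generic `d`: the face weights' block-ℓ¹ law `≤ N·(d+1)` at the centred root, in TT3a's letter), `faceSum_apply₂`, `mass_blk_finset_sum_smul_le`
(plain masses).  §2 (`d = 3`, `[NeZero N]`): `mass_blk_faceSum_outer_le`, **`hGB_of_hBm`** (`N⁷`), `mass_blk_faceSum_inner_le`, **`hHB_of_hBm`** (`N⁷`), **`hJB_of_hBm`** (`N⁶`).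
Unit `b2b-balaban-gan24-formalise-leaf-05` (gen 59), G-an2-4 swarm leaf prover 05, road «BF-x» supplier; INTENT-1 «PAIR-FACE-SUM-MASS ∕ PAIR-FACE-CONTACT» (journal).
-/

noncomputable section

open Finset
open scoped BigOperators
open Literature.MathematicalPhysics.QuantumFieldTheory
open Literature.MathematicalPhysics.QuantumFieldTheory.Balaban1983to89
open Literature.MathematicalPhysics.QuantumFieldTheory.Balaban1983to89.Beta
open B12Sec2to5 (l1 l1_nonneg)
open ExpKernelCalculus (Site MKer l1_natSmul l1_sub_triangle l1_sub_symm)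
open AffineAveraging (box toSite)
open AveragingContoursRooted (ctrOff)
open OneStepResolventKernel (Fib)
open KKTFluctuationKernel (delta1)
open Summit.QuantumFields.BalabanUV.Beta.D1BFx.PackedKernelSplit (blk)
open Summit.QuantumFields.BalabanUV.Beta.KernelWardRelative (gaugeWt)
open Summit.QuantumFields.BalabanUV.Beta.CompositeCorrectorKernel (indR)
open Summit.QuantumFields.BalabanUV.Beta.SymGaugeMultiplierBlockMean (bondIndR_eq_delta1)
open Summit.QuantumFields.BalabanUV.Beta.SymCorrectorFace (faceWt faceSum bondNbhd faceSum_eq_sum_sigma l1_le_of_mem_bondNbhd)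
open Summit.QuantumFields.BalabanUV.Beta.BlockFaceCount (sum_univ_sum_abs_gaugeWt_le)
open Summit.QuantumFields.BalabanUV.Beta.BondIndicatorGaugeL1 (sum_box_abs_zetaS_delta1_le)
open Summit.QuantumFields.BalabanUV.Beta.D1BFx.PackedColumnBlockTotalMass (l1_toSite_le_of_mem_box)
open Summit.QuantumFields.BalabanUV.Beta.D1BFx.PackedColumnBlockIndexedMass (blk_finset_sum_smul)

namespace Summit.QuantumFields.BalabanUV.Beta.D1BFx.PackedPairFaceSumMass

/-! ## §1 Tools -/

section Tools

/-- [folklore] **TWO-SLOT DECAY AT THE BLOCK-SCALE RATE, READ IN BLOCK UNITS FROM TWO NEIGHBOURHOODS** (generic dimension `D`, `0 < N`, `0 ≤ θ`): if `u` lies within `R` of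
`N•y₁` and `u′` within `R` of `N•y₂` (in `ℓ¹`), then `e^{−(θ∕N)|u′ − u|₁} ≤ e^{2θR∕N}·e^{−θ|y₂ − y₁|₁}` (`N|y₂ − y₁|₁ ≤ |N•y₂ − u′|₁ + |u′ − u|₁ + |u − N•y₁|₁`). -/
theorem exp_pairSlot_le {D N : ℕ} (hN : 0 < N) {θ R : ℝ} (hθ : 0 ≤ θ) {u u' : Site D} (y₁ y₂ : Site D)
    (hu : l1 (u - (N : ℤ) • y₁) ≤ R) (hu' : l1 (u' - (N : ℤ) • y₂) ≤ R) :
    Real.exp (-(θ / (N : ℝ)) * l1 (u' - u)) ≤ Real.exp (2 * θ * R / (N : ℝ)) * Real.exp (-θ * l1 (y₂ - y₁)) := by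
  rw [← Real.exp_add]
  refine Real.exp_le_exp.2 ?_
  have hNr : (0 : ℝ) < (N : ℝ) := by exact_mod_cast hN
  have e1 : l1 ((N : ℤ) • y₂ - (N : ℤ) • y₁) = (N : ℝ) * l1 (y₂ - y₁) := by rw [← smul_sub, l1_natSmul]
  have t1 := l1_sub_triangle ((N : ℤ) • y₂) u' ((N : ℤ) • y₁)
  have t2 := l1_sub_triangle u' u ((N : ℤ) • y₁)
  rw [e1, l1_sub_symm ((N : ℤ) • y₂) u'] at t1
  have key : (N : ℝ) * l1 (y₂ - y₁) ≤ 2 * R + l1 (u' - u) := by linarith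
  have hk := mul_le_mul_of_nonneg_left key (div_nonneg hθ hNr.le)
  have e2 : θ / (N : ℝ) * ((N : ℝ) * l1 (y₂ - y₁)) = θ * l1 (y₂ - y₁) := by field_simp
  have e3 : θ / (N : ℝ) * (2 * R + l1 (u' - u)) = 2 * θ * R / (N : ℝ) + θ / (N : ℝ) * l1 (u' - u) := by ring
  rw [e2, e3] at hk
  linarith

/-- [folklore] `d = 3` reading: both slots within `(3+1)·N` of their block corners ⟹ `e^{−(θ∕N)|u′ − u|₁} ≤ e^{8θ}·e^{−θ|y₂ − y₁|₁}`. -/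
theorem exp_pairSlot_le_four {N : ℕ} (hN : 0 < N) {θ : ℝ} (hθ : 0 ≤ θ) {u u' : Site 4} (y₁ y₂ : Site 4)
    (hu : l1 (u - (N : ℤ) • y₁) ≤ ((3 + 1 : ℕ) : ℝ) * (N : ℝ)) (hu' : l1 (u' - (N : ℤ) • y₂) ≤ ((3 + 1 : ℕ) : ℝ) * (N : ℝ)) :
    Real.exp (-(θ / (N : ℝ)) * l1 (u' - u)) ≤ Real.exp (8 * θ) * Real.exp (-θ * l1 (y₂ - y₁)) := by
  have h := exp_pairSlot_le hN hθ y₁ y₂ hu hu'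
  have hNr : (N : ℝ) ≠ 0 := by exact_mod_cast hN.ne'
  have e : 2 * θ * (((3 + 1 : ℕ) : ℝ) * (N : ℝ)) / (N : ℝ) = 8 * θ := by field_simp; push_cast; ring
  rwa [e] at h

/-- [folklore] **A SLOT OF THE FACE NEIGHBOURHOOD OF THE BLOCK `y` LIES WITHIN `(d+1)·N` OF `N•y`** (leaf-03's `l1_le_of_mem_bondNbhd` at the corner `N•y`, `blk N (N•y) = y`). -/
theorem l1_sub_nsmul_le_of_mem_bondNbhd {d N : ℕ} (hN : 0 < N) {y u : Site (d + 1)} {κ : Fin (d + 1)} (hu : u ∈ bondNbhd N y κ) :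
    l1 (u - (N : ℤ) • y) ≤ ((d + 1 : ℕ) : ℝ) * (N : ℝ) := by
  have h0 : (fun _ : Fin (d + 1) => (0 : ℕ)) ∈ box (d + 1) N := Fintype.mem_piFinset.2 fun _ => Finset.mem_range.2 hN
  have hblk : AveragingContours.blk N ((N : ℤ) • y) = y := by
    have h := AveragingContours.blk_block y h0
    have e : toSite (fun _ : Fin (d + 1) => (0 : ℕ)) = (0 : Site (d + 1)) := by funext i; simp [toSite]
    rwa [e, add_zero] at h
  have hu' : u ∈ bondNbhd N (AveragingContours.blk N ((N : ℤ) • y)) κ := by rwa [hblk]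
  exact l1_le_of_mem_bondNbhd hN hu'

/-- [folklore] **A SLOT OF THE BLOCK `y` LIES WITHIN `D·N` OF `N•y`** (`|toSite b|₁ ≤ D·N`). -/
theorem l1_sub_nsmul_le_of_mem_box {D N : ℕ} (y : Site D) {b : Fin D → ℕ} (hb : b ∈ box D N) :
    l1 ((N : ℤ) • y + toSite b - (N : ℤ) • y) ≤ (D : ℝ) * (N : ℝ) := by
  rw [add_sub_cancel_left]; exact l1_toSite_le_of_mem_box hb

/-- [folklore] **THE FACE WEIGHTS' BLOCK-ℓ¹ LAW AT THE CENTRED ROOT, IN TT3a's LETTER** (generic `d`, `1 ≤ N`): `Σ_{b ∈ box} |faceWt ρ_c N κ (N•y′ + b)| ≤ N·(d+1)`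
(«COMB-WEIGHT-BLOCK-L1» `sum_box_abs_zetaS_delta1_le` with `indR = delta1`). -/
theorem sum_box_abs_faceWt_ctrOff_le {d N : ℕ} (hN : 1 ≤ N) (κ : Fin (d + 1)) (y' : Site (d + 1)) :
    ∑ b ∈ box (d + 1) N, |faceWt (ctrOff (d + 1) N) N κ ((N : ℤ) • y' + toSite b)| ≤ (N : ℝ) * ((d : ℝ) + 1) := by
  have e : ∀ x : Site (d + 1), indR κ x = delta1 κ x := fun x => bondIndR_eq_delta1 κ x
  refine le_of_eq_of_le (Finset.sum_congr rfl fun b _ => ?_) (sum_box_abs_zetaS_delta1_le (d := d) hN κ y')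
  rw [faceWt, e]

/-- [folklore] **THE FACE SUM OF A PAIR FAMILY, EVALUATED AT THE INNER SLOT**: `faceSum n S₂ Y κ′ u′ = Σ_{s ∈ univ.sigma (bondNbhd n Y)} gaugeWt n Y s.1 s.2 • S₂ s.1 s.2 κ′ u′`. -/
theorem faceSum_apply₂ {d : ℕ} {E : Type*} [AddCommGroup E] [Module ℝ E] (n : ℕ) (S₂ : Fin (d + 1) → Site (d + 1) → Fin (d + 1) → Site (d + 1) → E)
    (Y : Site (d + 1)) (κ' : Fin (d + 1)) (u' : Site (d + 1)) :
    faceSum n S₂ Y κ' u' = ∑ s ∈ (Finset.univ : Finset (Fin (d + 1))).sigma (bondNbhd n Y), gaugeWt n Y s.1 s.2 • S₂ s.1 s.2 κ' u' := by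
  rw [faceSum_eq_sum_sigma, Finset.sum_apply, Finset.sum_apply]
  rfl

/-- [folklore] **THE PLAIN BLOCK MASSES OF A FINITE SIGNED COMBINATION OF PACKED TABLES** (`d = 3`; d1-leaf-02's `GhostWordJetMass.mass_finset_sum_le` at unit weight +
`blk_finset_sum_smul`): `Σ_{s ∈ Φ} a s • T s` has summable plain block masses `≤ Σ_{s ∈ Φ} |a s|·ρ s` when each `T s` has them `≤ ρ s`. -/
theorem mass_blk_finset_sum_smul_le {ι : Type*} (Φ : Finset ι) {a : ι → ℝ} {T : ι → MKer 4 (Fib 3)} {ρ : ι → ℝ} (j k : Bool)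
    (hTs : ∀ s ∈ Φ, Summable fun p : Site 4 × Site 4 => ∑ g, ∑ f, |blk (T s) j k p.1 p.2 g f|)
    (hTm : ∀ s ∈ Φ, ∑' p : Site 4 × Site 4, ∑ g, ∑ f, |blk (T s) j k p.1 p.2 g f| ≤ ρ s) :
    (Summable fun p : Site 4 × Site 4 => ∑ g, ∑ f, |blk (∑ s ∈ Φ, a s • T s) j k p.1 p.2 g f|) ∧
      ∑' p : Site 4 × Site 4, ∑ g, ∑ f, |blk (∑ s ∈ Φ, a s • T s) j k p.1 p.2 g f| ≤ ∑ s ∈ Φ, |a s| * ρ s := by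
  rw [blk_finset_sum_smul]
  have hterm : ∀ s ∈ Φ, (Summable fun p : Site 4 × Site 4 => ∑ g, ∑ f, |(a s • blk (T s) j k) p.1 p.2 g f| * (1 : ℝ)) ∧
      ∑' p : Site 4 × Site 4, ∑ g, ∑ f, |(a s • blk (T s) j k) p.1 p.2 g f| * (1 : ℝ) ≤ |a s| * ρ s := by
    intro s hs
    exact Summit.QuantumFields.BalabanUV.Beta.D1BFx.GhostWordJetMass.mass_smul_le (W := fun _ => (1 : ℝ))
      (by simpa only [mul_one] using hTs s hs) (by simpa only [mul_one] using hTm s hs)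
  obtain ⟨h1, h2⟩ := Summit.QuantumFields.BalabanUV.Beta.D1BFx.GhostWordJetMass.mass_finset_sum_le Φ (K := fun s => a s • blk (T s) j k)
    (W := fun _ => (1 : ℝ)) (m := fun s => |a s| * ρ s) (fun _ => zero_le_one) (fun s hs => (hterm s hs).1) (fun s hs => (hterm s hs).2)
  exact ⟨by simpa only [mul_one] using h1, by simpa only [mul_one] using h2⟩

end Tools

/-! ## §2 `d = 3`: the three face-sum pair tables' letters from ONE per-slot-pair letter with two-slot block-scale decay -/

section Letters

variable (N : ℕ) [NeZero N] {S₂ : Fin 4 → Site 4 → Fin 4 → Site 4 → MKer 4 (Fib 3)} {θ : ℝ} {mB : Bool → Bool → ℝ}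
  (hθ : 0 ≤ θ) (hmB : ∀ j i, 0 ≤ mB j i)
  (hBs : ∀ κ u κ' u' j i, Summable fun p : Site 4 × Site 4 => ∑ g, ∑ f, |blk (S₂ κ u κ' u') j i p.1 p.2 g f|)
  (hBm : ∀ κ u κ' u' j i, ∑' p : Site 4 × Site 4, ∑ g, ∑ f, |blk (S₂ κ u κ' u') j i p.1 p.2 g f|
    ≤ mB j i * Real.exp (-(θ / (N : ℝ)) * l1 (u' - u)))
include hθ hmB hBs hBm

/-- [folklore] **THE OUTER FACE-SUM PAIR TABLE AT A NEAR INNER SLOT** (`d = 3`): for an inner slot `u′` within `(3+1)·N` of `N•y₂`, every block of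
`faceSum N S₂ y₁ κ′ u′ = Σ_κ Σ_{u ∈ bondNbhd N y₁ κ} gaugeWt N y₁ κ u • S₂ κ u κ′ u′` has summable plain mass `≤ N³·(8·e^{8θ}·mB j i)·e^{−θ|y₂ − y₁|₁}`
(«FACE-COUNT» `Σ|gaugeWt| ≤ (3+1)·2N³`; the two-slot decay read in block units, §1). -/
theorem mass_blk_faceSum_outer_le (y₁ y₂ : Site 4) (κ' : Fin 4) {u' : Site 4} (hu' : l1 (u' - (N : ℤ) • y₂) ≤ ((3 + 1 : ℕ) : ℝ) * (N : ℝ)) (j i : Bool) :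
    (Summable fun p : Site 4 × Site 4 => ∑ g, ∑ f, |blk (faceSum (d := 3) N S₂ y₁ κ' u') j i p.1 p.2 g f|) ∧
      ∑' p : Site 4 × Site 4, ∑ g, ∑ f, |blk (faceSum (d := 3) N S₂ y₁ κ' u') j i p.1 p.2 g f|
        ≤ (N : ℝ) ^ 3 * (8 * Real.exp (8 * θ) * mB j i) * Real.exp (-θ * l1 (y₂ - y₁)) := by
  have hN0 : 0 < N := Nat.pos_of_ne_zero (NeZero.ne N)
  have hN1 : 1 ≤ N := hN0
  have hX : 0 ≤ mB j i * (Real.exp (8 * θ) * Real.exp (-θ * l1 (y₂ - y₁))) := mul_nonneg (hmB j i) (by positivity)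
  rw [faceSum_apply₂]
  obtain ⟨hs, hb⟩ := mass_blk_finset_sum_smul_le ((Finset.univ : Finset (Fin (3 + 1))).sigma (bondNbhd N y₁))
    (a := fun s => gaugeWt N y₁ s.1 s.2) (T := fun s => S₂ s.1 s.2 κ' u')
    (ρ := fun _ => mB j i * (Real.exp (8 * θ) * Real.exp (-θ * l1 (y₂ - y₁)))) j i
    (fun s _ => hBs s.1 s.2 κ' u' j i)
    (fun s hs => (hBm s.1 s.2 κ' u' j i).trans (mul_le_mul_of_nonneg_left
      (exp_pairSlot_le_four hN0 hθ y₁ y₂ (l1_sub_nsmul_le_of_mem_bondNbhd hN0 (Finset.mem_sigma.1 hs).2) hu') (hmB j i)))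
  refine ⟨hs, hb.trans ?_⟩
  rw [← Finset.sum_mul, Finset.sum_sigma]
  calc (∑ κ : Fin (3 + 1), ∑ u ∈ bondNbhd N y₁ κ, |gaugeWt N y₁ κ u|) * (mB j i * (Real.exp (8 * θ) * Real.exp (-θ * l1 (y₂ - y₁))))
      ≤ (((3 : ℝ) + 1) * (2 * (N : ℝ) ^ 3)) * (mB j i * (Real.exp (8 * θ) * Real.exp (-θ * l1 (y₂ - y₁)))) :=
        mul_le_mul_of_nonneg_right (by exact_mod_cast sum_univ_sum_abs_gaugeWt_le (d := 3) hN1 y₁ (bondNbhd N y₁)) hX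
    _ = (N : ℝ) ^ 3 * (8 * Real.exp (8 * θ) * mB j i) * Real.exp (-θ * l1 (y₂ - y₁)) := by ring

/-- [folklore] **«PAIR-FACE-PACK»'s OUTER LETTER `hGB` FROM `hBm`** (`N⁷ = N⁴` inner slots of the block `×` the `8N³` of the face count):
`Σ_{b′ ∈ box} M(blk (faceSum N S₂ y₁ κ′ (N•y₂ + b′)) j i) ≤ N⁷·(8·e^{8θ}·mB j i)·e^{−θ|y₂ − y₁|₁}`. -/
theorem hGB_of_hBm (κ' : Fin 4) (y₁ y₂ : Site 4) (j i : Bool) :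
    ∑ b' ∈ box 4 N, (∑' p : Site 4 × Site 4, ∑ g, ∑ f,
        |blk (faceSum (d := 3) N S₂ y₁ κ' (((N : ℕ) : ℤ) • y₂ + toSite b')) j i p.1 p.2 g f|)
      ≤ (N : ℝ) ^ 7 * (8 * Real.exp (8 * θ) * mB j i) * Real.exp (-θ * l1 (y₂ - y₁)) := by
  have hcard : ((box 4 N).card : ℝ) = (N : ℝ) ^ 4 := by
    simp [AffineAveraging.box, Fintype.card_piFinset, Finset.card_range, Finset.prod_const, Finset.card_univ, Fintype.card_fin]
  calc ∑ b' ∈ box 4 N, (∑' p : Site 4 × Site 4, ∑ g, ∑ f,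
          |blk (faceSum (d := 3) N S₂ y₁ κ' (((N : ℕ) : ℤ) • y₂ + toSite b')) j i p.1 p.2 g f|)
      ≤ ∑ _b' ∈ box 4 N, (N : ℝ) ^ 3 * (8 * Real.exp (8 * θ) * mB j i) * Real.exp (-θ * l1 (y₂ - y₁)) :=
        Finset.sum_le_sum fun b' hb' => (mass_blk_faceSum_outer_le N hθ hmB hBs hBm y₁ y₂ κ'
          ((l1_sub_nsmul_le_of_mem_box y₂ hb').trans (le_of_eq (by norm_num))) j i).2
    _ = (N : ℝ) ^ 4 * ((N : ℝ) ^ 3 * (8 * Real.exp (8 * θ) * mB j i) * Real.exp (-θ * l1 (y₂ - y₁))) := by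
        rw [Finset.sum_const, nsmul_eq_mul, hcard]
    _ = (N : ℝ) ^ 7 * (8 * Real.exp (8 * θ) * mB j i) * Real.exp (-θ * l1 (y₂ - y₁)) := by ring

/-- [folklore] **THE INNER FACE-SUM TABLE OF A NEAR OUTER SLOT** (`d = 3`): for an outer slot `u` within `(3+1)·N` of `N•y₁`, every block of
`faceSum N (S₂ κ u) y₂ = Σ_{κ″} Σ_{u′ ∈ bondNbhd N y₂ κ″} gaugeWt N y₂ κ″ u′ • S₂ κ u κ″ u′` has summable plain mass `≤ N³·(8·e^{8θ}·mB j i)·e^{−θ|y₂ − y₁|₁}`. -/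
theorem mass_blk_faceSum_inner_le (y₁ y₂ : Site 4) (κ : Fin 4) {u : Site 4} (hu : l1 (u - (N : ℤ) • y₁) ≤ ((3 + 1 : ℕ) : ℝ) * (N : ℝ)) (j i : Bool) :
    (Summable fun p : Site 4 × Site 4 => ∑ g, ∑ f, |blk (faceSum (d := 3) N (S₂ κ u) y₂) j i p.1 p.2 g f|) ∧
      ∑' p : Site 4 × Site 4, ∑ g, ∑ f, |blk (faceSum (d := 3) N (S₂ κ u) y₂) j i p.1 p.2 g f|
        ≤ (N : ℝ) ^ 3 * (8 * Real.exp (8 * θ) * mB j i) * Real.exp (-θ * l1 (y₂ - y₁)) := by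
  have hN0 : 0 < N := Nat.pos_of_ne_zero (NeZero.ne N)
  have hN1 : 1 ≤ N := hN0
  have hX : 0 ≤ mB j i * (Real.exp (8 * θ) * Real.exp (-θ * l1 (y₂ - y₁))) := mul_nonneg (hmB j i) (by positivity)
  rw [faceSum_eq_sum_sigma]
  obtain ⟨hs, hb⟩ := mass_blk_finset_sum_smul_le ((Finset.univ : Finset (Fin (3 + 1))).sigma (bondNbhd N y₂))
    (a := fun s => gaugeWt N y₂ s.1 s.2) (T := fun s => S₂ κ u s.1 s.2)
    (ρ := fun _ => mB j i * (Real.exp (8 * θ) * Real.exp (-θ * l1 (y₂ - y₁)))) j i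
    (fun s _ => hBs κ u s.1 s.2 j i)
    (fun s hs => (hBm κ u s.1 s.2 j i).trans (mul_le_mul_of_nonneg_left
      (exp_pairSlot_le_four hN0 hθ y₁ y₂ hu (l1_sub_nsmul_le_of_mem_bondNbhd hN0 (Finset.mem_sigma.1 hs).2)) (hmB j i)))
  refine ⟨hs, hb.trans ?_⟩
  rw [← Finset.sum_mul, Finset.sum_sigma]
  calc (∑ κ'' : Fin (3 + 1), ∑ u' ∈ bondNbhd N y₂ κ'', |gaugeWt N y₂ κ'' u'|) * (mB j i * (Real.exp (8 * θ) * Real.exp (-θ * l1 (y₂ - y₁))))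
      ≤ (((3 : ℝ) + 1) * (2 * (N : ℝ) ^ 3)) * (mB j i * (Real.exp (8 * θ) * Real.exp (-θ * l1 (y₂ - y₁)))) :=
        mul_le_mul_of_nonneg_right (by exact_mod_cast sum_univ_sum_abs_gaugeWt_le (d := 3) hN1 y₂ (bondNbhd N y₂)) hX
    _ = (N : ℝ) ^ 3 * (8 * Real.exp (8 * θ) * mB j i) * Real.exp (-θ * l1 (y₂ - y₁)) := by ring

/-- [folklore] **«PAIR-FACE-PACK»'s INNER LETTER `hHB` FROM `hBm`**: `Σ_{b ∈ box} M(blk (faceSum N (S₂ κ (N•y₁ + b)) y₂) j i) ≤ N⁷·(8·e^{8θ}·mB j i)·e^{−θ|y₂ − y₁|₁}`. -/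
theorem hHB_of_hBm (κ : Fin 4) (y₁ y₂ : Site 4) (j i : Bool) :
    ∑ b ∈ box 4 N, (∑' p : Site 4 × Site 4, ∑ g, ∑ f,
        |blk (faceSum (d := 3) N (S₂ κ (((N : ℕ) : ℤ) • y₁ + toSite b)) y₂) j i p.1 p.2 g f|)
      ≤ (N : ℝ) ^ 7 * (8 * Real.exp (8 * θ) * mB j i) * Real.exp (-θ * l1 (y₂ - y₁)) := by
  have hcard : ((box 4 N).card : ℝ) = (N : ℝ) ^ 4 := by
    simp [AffineAveraging.box, Fintype.card_piFinset, Finset.card_range, Finset.prod_const, Finset.card_univ, Fintype.card_fin]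
  calc ∑ b ∈ box 4 N, (∑' p : Site 4 × Site 4, ∑ g, ∑ f,
          |blk (faceSum (d := 3) N (S₂ κ (((N : ℕ) : ℤ) • y₁ + toSite b)) y₂) j i p.1 p.2 g f|)
      ≤ ∑ _b ∈ box 4 N, (N : ℝ) ^ 3 * (8 * Real.exp (8 * θ) * mB j i) * Real.exp (-θ * l1 (y₂ - y₁)) :=
        Finset.sum_le_sum fun b hb => (mass_blk_faceSum_inner_le N hθ hmB hBs hBm y₁ y₂ κ
          ((l1_sub_nsmul_le_of_mem_box y₁ hb).trans (le_of_eq (by norm_num))) j i).2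
    _ = (N : ℝ) ^ 4 * ((N : ℝ) ^ 3 * (8 * Real.exp (8 * θ) * mB j i) * Real.exp (-θ * l1 (y₂ - y₁))) := by
        rw [Finset.sum_const, nsmul_eq_mul, hcard]
    _ = (N : ℝ) ^ 7 * (8 * Real.exp (8 * θ) * mB j i) * Real.exp (-θ * l1 (y₂ - y₁)) := by ring

/-- [folklore] **«PAIR-FACE-PACK»'s FACE × FACE LETTER `hJB` FROM `hBm`** (`N⁶ = 8N³·8N³`): every block of the double face sum
`faceSum N (faceSum N S₂ y₁) y₂` has summable plain mass `≤ N⁶·(64·e^{8θ}·mB j i)·e^{−θ|y₂ − y₁|₁}`. -/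
theorem hJB_of_hBm (y₁ y₂ : Site 4) (j i : Bool) :
    (Summable fun p : Site 4 × Site 4 => ∑ g, ∑ f, |blk (faceSum (d := 3) N (faceSum (d := 3) N S₂ y₁) y₂) j i p.1 p.2 g f|) ∧
      ∑' p : Site 4 × Site 4, ∑ g, ∑ f, |blk (faceSum (d := 3) N (faceSum (d := 3) N S₂ y₁) y₂) j i p.1 p.2 g f|
        ≤ (N : ℝ) ^ 6 * (64 * Real.exp (8 * θ) * mB j i) * Real.exp (-θ * l1 (y₂ - y₁)) := by
  have hN0 : 0 < N := Nat.pos_of_ne_zero (NeZero.ne N)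
  have hN1 : 1 ≤ N := hN0
  have hX : 0 ≤ (N : ℝ) ^ 3 * (8 * Real.exp (8 * θ) * mB j i) * Real.exp (-θ * l1 (y₂ - y₁)) := by
    have := hmB j i; positivity
  rw [faceSum_eq_sum_sigma (T := faceSum (d := 3) N S₂ y₁)]
  obtain ⟨hs, hb⟩ := mass_blk_finset_sum_smul_le ((Finset.univ : Finset (Fin (3 + 1))).sigma (bondNbhd N y₂))
    (a := fun s => gaugeWt N y₂ s.1 s.2) (T := fun s => faceSum (d := 3) N S₂ y₁ s.1 s.2)
    (ρ := fun _ => (N : ℝ) ^ 3 * (8 * Real.exp (8 * θ) * mB j i) * Real.exp (-θ * l1 (y₂ - y₁))) j i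
    (fun s hs => (mass_blk_faceSum_outer_le N hθ hmB hBs hBm y₁ y₂ s.1 (l1_sub_nsmul_le_of_mem_bondNbhd hN0 (Finset.mem_sigma.1 hs).2) j i).1)
    (fun s hs => (mass_blk_faceSum_outer_le N hθ hmB hBs hBm y₁ y₂ s.1 (l1_sub_nsmul_le_of_mem_bondNbhd hN0 (Finset.mem_sigma.1 hs).2) j i).2)
  refine ⟨hs, hb.trans ?_⟩
  rw [← Finset.sum_mul, Finset.sum_sigma]
  calc (∑ κ'' : Fin (3 + 1), ∑ u' ∈ bondNbhd N y₂ κ'', |gaugeWt N y₂ κ'' u'|) * ((N : ℝ) ^ 3 * (8 * Real.exp (8 * θ) * mB j i) * Real.exp (-θ * l1 (y₂ - y₁)))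
      ≤ (((3 : ℝ) + 1) * (2 * (N : ℝ) ^ 3)) * ((N : ℝ) ^ 3 * (8 * Real.exp (8 * θ) * mB j i) * Real.exp (-θ * l1 (y₂ - y₁))) :=
        mul_le_mul_of_nonneg_right (by exact_mod_cast sum_univ_sum_abs_gaugeWt_le (d := 3) hN1 y₂ (bondNbhd N y₂)) hX
    _ = (N : ℝ) ^ 6 * (64 * Real.exp (8 * θ) * mB j i) * Real.exp (-θ * l1 (y₂ - y₁)) := by ring

end Letters

end Summit.QuantumFields.BalabanUV.Beta.D1BFx.PackedPairFaceSumMass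

end
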